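import Summits.BirchSwinnertonDyer.BirchSwinnertonDyer.Theorems.SylvesterTwoHeegnerIndexLowerHalfCertificates
import HarnessLib

/-!
# Route `SylvesterTwoHeegnerIndex` (rung K7t), crux `HeegnerIndexLowerAtTwoHSY` (item 19230):
# the LOWER crux at the 𝒞_HSY members `p ≤ 10⁵` with `(ℤ/4)² ↪ Ш(E_p)` — member-generic consumer
# and the certified rows (helper toward stmt-BirchSwinnertonDyer-19230; cell «bsd-cm», seat
# `bsd-cm-k7t-c3` g3; theorems only)

HONEST FRAMING (cell «bsd-cm», `run/shared/lean/pub/bsd-cm/`; FULL-BSD RANK ≤ 1 programme, tranche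
1a): the class 𝒞_HSY at `p = 2` (B14 / O12: `BSD(E_p, 2)` for `E_p : x³ + y³ = p`, `p ≡ 4, 7 (mod 9)`
prime, `3 ∉ 𝔽_p^{×3}`) is OPEN in print and stays open here; the crux quantifies over ALL `p` and is
NOT proved here. THEOREMS ONLY (0 definitions, 0 named facts, 0 `sorry`). Every conclusion is
CONDITIONAL on `PublishedFactsTwo` (the route's support item 19231) and on DISPLAYED PER-CURVE
CERTIFICATE DATA that are NOT proved in the kernel:
* `hq : #Ш_an(E_p) = q` with `ord₂ q ≤ 4` — certified per member by the two-engine lattice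
  certificate of the cell (bsd-cm-two n5cert pipeline, base script sha16 e7a4af08f9556966, extended
  by an exact `3`-isogeny-descent generator search; kit j252028, this seat, evidence on item 19230);
* `hS : Ш(E_p) ⊇` a Klein four-group `{0, x, y, x + y}` killed by `2`, every element of `Ш(E_p)[2]`
  a double in `Ш(E_p)` — PARI 2.17 `ellrank(E_p) = [1, 3, 0, …]` at efforts `0–3` (`2`-Selmer rank
  `C = 3`, `2`-torsion rank `T = 0`, Cassels–Tate rank `s = dim Ш[2]/2Ш[4] = 0` — PARI's documented
  UNCONDITIONAL invariants), on a `bnfcertify`d cubic field `ℚ(∛(4p))` (GRH-free); with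
  `rank E_p(ℚ) = 1` (Hu–Shu–Yin Thm 1.3): `Ш(E_p)[2] ≅ (ℤ/2)² ⊆ 2·Ш(E_p)` (kit j250796 / j252028).
From these §1 gives the crux body at `p` in EVERY Heegner frame (`lower_member_of_cert`), and what
`BSD(E_p, 2)` then amounts to (`bsdTwo_member_iff_not_dvd_of_cert`: `¬ 2^(ord₂ q + 1) ∣ #Ш(E_p)`, a
`4`-Selmer Cassels–Tate question the cell's toolbelt cannot decide — note for item 19229).
§2 = the member rows. These fourteen members (`p = 18913` of the sibling file
`SylvesterTwoHeegnerIndexLowerHalfWitness18913` and the thirteen `2·10⁴ < p ≤ 10⁵` below) are the COMPLETE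
list `p ≤ 10⁵` at which the lower crux says more than a `2`-descent (kit j250796: `2132` members,
`1904 + 214` decided by `Ш[2^∞] = 0` resp. `Ш ≅ (ℤ/2)²`-type rows).

PARTITION (D-0054): CornerF at `2` / O12 × the 𝒞_HSY members with `(ℤ/4)² ↪ Ш(E_p)`, `p ≤ 10⁵`
(book230: 0 classes, `N = 27p²` or `9p² > 5·10⁵`) × `p = 2` — per-pair certificate consumers; closes
no cell and no class; nothing booked; no label moves. NOT a proof of the crux or of `BSD(E_p, 2)`.
References (locators only): [HuShuYin2019] Thm. 1.3/1.4 (p. 3), Cor. 4.4; [BurungaleFlach2024]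
Thm. 1.1, Cor. 2; [Miller2011LMS] §1, Def. 1.1; [Cremona1997] §3.6; Cassels 1998 (Crelle 494) §1;
Silverman, Math. Comp. 55 (1990) Thm. 1.1 (height bounds of the index certificate).
-/

set_option autoImplicit false
-- the Theorems namespace `Summit.BirchSwinnertonDyer.BirchSwinnertonDyer.…` repeats a component by design (D-0017 layout)
set_option linter.dupNamespace false

noncomputable section

open scoped Classical

open WeierstrassCurve NumberField Literature.NumberTheory.EllipticCurves
  Literature.NumberTheory.EllipticCurves.ModularForms
  Literature.NumberTheory.EllipticCurves.Rank1Residual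
  Literature.NumberTheory.EllipticCurves.Rank1Residual.Typed
  Literature.NumberTheory.EllipticCurves.HuShuYin2019
  Summit.BirchSwinnertonDyer.Rank1Residual.P2
  Summit.BirchSwinnertonDyer.Rank1Residual.X12.Sylvester
  Summit.BirchSwinnertonDyer.BirchSwinnertonDyer.Theses.SylvesterTwoHeegnerIndex

namespace Summit.BirchSwinnertonDyer.BirchSwinnertonDyer.Theorems

namespace SylvesterTwoLowerCert

/-! ## §1 Member-generic consumers -/

/-- The 𝒞_HSY parameter condition at `p`: prime, `p ≡ 4, 7 (mod 9)`, `3` not a cube mod `p`.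
(An abbreviation-free conjunction, so that member rows display it verbatim.) [folklore] -/
theorem hsy_of_pow_mod_ne_one {p : ℕ} (hp : p.Prime) (h9 : p % 9 = 4 ∨ p % 9 = 7)
    (hE : 3 ^ ((p - 1) / 3) % p ≠ 1) :
    Nat.Prime p ∧ (p % 9 = 4 ∨ p % 9 = 7) ∧ ¬ ∃ x : ZMod p, x ^ 3 = 3 := by
  refine ⟨hp, h9, ?_⟩
  rintro ⟨x, hx⟩
  haveI : Fact p.Prime := ⟨hp⟩
  -- `3 ∣ p - 1` from `p ≡ 4, 7 (mod 9)`
  have h3 : 3 ∣ p - 1 := by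
    have hp1 : 1 ≤ p := hp.one_lt.le
    rcases h9 with h | h <;> omega
  obtain ⟨e, he⟩ := h3
  have hp3 : p ≠ 3 := by rintro rfl; simp at h9
  -- pass to `a = x.val ∈ ℕ`: `a³ ≡ 3 (mod p)`
  set a : ℕ := x.val with ha
  have hxa : (a : ZMod p) = x := ZMod.natCast_zmod_val x
  have h3m : a ^ 3 ≡ 3 [MOD p] := by
    refine (ZMod.natCast_eq_natCast_iff' _ _ _).mp ?_
    rw [Nat.cast_pow, hxa, hx, Nat.cast_ofNat]
  have ha0 : a ≠ 0 := by
    intro h0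
    rw [h0, zero_pow three_ne_zero] at h3m
    -- `0 ≡ 3 (mod p)` forces `p ∣ 3`, i.e. `p = 3`
    have : p ∣ 3 := (Nat.modEq_zero_iff_dvd.mp h3m.symm)
    exact hp3 ((Nat.prime_dvd_prime_iff_eq hp Nat.prime_three).mp this)
  have hcop : Nat.Coprime a p :=
    (Nat.coprime_comm.mp ((Nat.Prime.coprime_iff_not_dvd hp).mpr fun hdvd =>
      ha0 (Nat.eq_zero_of_dvd_of_lt hdvd (ZMod.val_lt x))))
  -- Euler/Fermat: `a^(p-1) ≡ 1`, hence `3^e ≡ (a³)^e = a^(p-1) ≡ 1 (mod p)`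
  have hφ : Nat.totient p = 3 * e := by rw [Nat.totient_prime hp, he]
  have hEul : (a ^ 3) ^ e ≡ 1 [MOD p] := by
    have := Nat.ModEq.pow_totient hcop
    rwa [hφ, pow_mul] at this
  have h3e : 3 ^ e ≡ 1 [MOD p] := (h3m.pow e).symm.trans hEul
  have he' : (p - 1) / 3 = e := by rw [he]; simp
  apply hE
  rw [he', h3e, Nat.one_mod_eq_one.mpr hp.one_lt.ne']

/-- `ord₂ 16 = 4` in `ℚ`. [folklore] -/
theorem padicValRat_two_16 : padicValRat 2 (16 : ℚ) = 4 := by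
  rw [show (16 : ℚ) = ((2 ^ 4 : ℕ) : ℚ) by norm_num, padicValRat.of_nat, padicValNat.prime_pow]
  norm_num

section Consumers

variable {p : ℕ}

/-- **Member-generic LOWER consumer.** At an 𝒞_HSY parameter `p`, from the route's support item
`PublishedFactsTwo` and two DISPLAYED per-curve certificates — `hq : #Ш_an(E_p) = q` with
`ord₂ q ≤ 4`, and `hS :` a Klein four-group in `Ш(E_p)[2]` with `Ш(E_p)[2] ⊆ 2·Ш(E_p)` (so
`(ℤ/4)² ↪ Ш(E_p)`, `16 ∣ #Ш(E_p)`) — the body of `HeegnerIndexLowerAtTwoHSY` at `p` holds for EVERY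
global minimal model `W` of `E_p` and EVERY Heegner frame: `ord₂ 𝔮 = ord₂ q ≤ 4 ≤ ord₂ #Ш(W)`.
CONDITIONAL; EVIDENCE consumer; says nothing about other `p`.
[cite: HuShuYin2019, Thm. 1.3 and Thm. 1.4 (p. 3)] [cite: BurungaleFlach2024, Thm. 1.1 and Cor. 2]
[cite: Miller2011LMS, §1 and Def. 1.1] [cite: Cremona1997, §3.6] -/
theorem lower_member_of_cert
    (hsy : Nat.Prime p ∧ (p % 9 = 4 ∨ p % 9 = 7) ∧ ¬ ∃ x : ZMod p, x ^ 3 = 3)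
    (hF : PublishedFactsTwo) {q : ℚ} (hv : padicValRat 2 q ≤ 4)
    (hq : ∀ (W : WeierstrassCurve ℚ) [W.IsElliptic] [W.IsGloballyMinimal],
      (∃ C : VariableChange ℚ, C • W = cubeSumCurve (p : ℚ)) → shaAn W = (q : ℂ))
    (hS : ∀ (W : WeierstrassCurve ℚ) [W.IsElliptic] [W.IsGloballyMinimal],
      (∃ C : VariableChange ℚ, C • W = cubeSumCurve (p : ℚ)) →
        (∃ x y : W.sha, (2 : ℤ) • x = 0 ∧ (2 : ℤ) • y = 0 ∧ x ≠ 0 ∧ y ≠ 0 ∧ x ≠ y) ∧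
        (∀ z : W.sha, (2 : ℤ) • z = 0 → ∃ w : W.sha, (2 : ℤ) • w = z)) :
    ∀ (W : WeierstrassCurve ℚ) [W.IsElliptic] [W.IsGloballyMinimal],
      (∃ C : VariableChange ℚ, C • W = cubeSumCurve (p : ℚ)) →
      ∀ (N : ℕ) [NeZero N] (K : Type) [Field K] [NumberField K]
        (Dt : ModularParametrizationData W N) (H : HeegnerDatum N (NumberField.discr K)) (ι : K →+* ℂ)
        (P : (W.baseChange K).toAffine.Point) (Wd : WeierstrassCurve ℚ) [Wd.IsElliptic]
        [Wd.IsGloballyMinimal] (Cd : VariableChange ℚ) (k : ℕ),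
        W.HasCM → W.analyticRank = 1 → IsImaginaryQuadratic K → SatisfiesHeegnerHypothesis N K →
        WeierstrassCurve.Affine.Point.map ι.toRatAlgHom P = heegnerPointComplex Dt H →
        (W.quadraticTwist (NumberField.discr K : ℚ)).entireLFunction 1 ≠ 0 →
        Cd • W.quadraticTwist (NumberField.discr K : ℚ) = Wd → (k = 1 ∨ k = 2) →
        (k = 2 ↔ ∀ y : W.toAffine.Point, ∃ Q : (W.baseChange K).toAffine.Point,
          QuadraticDescent.incl K W y - (2 : ℤ) • Q ∈ AddCommGroup.torsion (W.baseChange K).toAffine.Point) →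
        padicValRat 2 (cmHeegnerIndexQuotient W K P Dt.c k Wd Cd.u) ≤
          padicValNat 2 (Nat.card W.sha) := by
  obtain ⟨hHSY, hBF, hmod, -, -, hGZ, hKo, hGZK, -, -, -⟩ := hF
  obtain ⟨hpr, h9, h3⟩ := hsy
  intro W _ _ hW N _ K _ _ Dt H ι P Wd _ _ Cd k _ _ hK hHN hP hLt hWd hk hkiff
  obtain ⟨hK4, hdiv⟩ := hS W hW
  exact lower_frame_of_kleinFour_twoDivisible W hHSY hBF hmod hGZK hpr h9 h3 hW (hq W hW) hv hK4 hdiv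
    N K Dt H ι P (hGZ N W K) (hKo N W K) hK hHN hP hLt Wd Cd hWd hk hkiff

/-- **What `BSD(E_p, 2)` amounts to at such a member**, granted `PublishedFactsTwo` and the same two
displayed certificates with `ord₂ q = 4` exactly: for every global minimal model `W` of `E_p`,
`BSDp W 2 ⟺ ¬ 32 ∣ #Ш(W)` — only `Ш(E_p)[2^∞] ≅ (ℤ/4)²` EXACTLY is left (the Cassels–Tate pairing
on `Ш[4]/Ш[2]` non-degenerate; a `4`-Selmer computation). CONDITIONAL; EVIDENCE consumer.
[cite: HuShuYin2019, Thm. 1.3 and Thm. 1.4 (p. 3)] [cite: BurungaleFlach2024, Thm. 1.1 and Cor. 2]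
[cite: Miller2011LMS, §1 and Def. 1.1] -/
theorem bsdTwo_member_iff_not_32_dvd_of_cert
    (hsy : Nat.Prime p ∧ (p % 9 = 4 ∨ p % 9 = 7) ∧ ¬ ∃ x : ZMod p, x ^ 3 = 3)
    (hF : PublishedFactsTwo) {q : ℚ} (hv : padicValRat 2 q = 4)
    (hq : ∀ (W : WeierstrassCurve ℚ) [W.IsElliptic] [W.IsGloballyMinimal],
      (∃ C : VariableChange ℚ, C • W = cubeSumCurve (p : ℚ)) → shaAn W = (q : ℂ))
    (hS : ∀ (W : WeierstrassCurve ℚ) [W.IsElliptic] [W.IsGloballyMinimal],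
      (∃ C : VariableChange ℚ, C • W = cubeSumCurve (p : ℚ)) →
        (∃ x y : W.sha, (2 : ℤ) • x = 0 ∧ (2 : ℤ) • y = 0 ∧ x ≠ 0 ∧ y ≠ 0 ∧ x ≠ y) ∧
        (∀ z : W.sha, (2 : ℤ) • z = 0 → ∃ w : W.sha, (2 : ℤ) • w = z))
    (W : WeierstrassCurve ℚ) [W.IsElliptic] [W.IsGloballyMinimal]
    (hW : ∃ C : VariableChange ℚ, C • W = cubeSumCurve (p : ℚ)) :
    BSDp W 2 ↔ ¬ 32 ∣ Nat.card W.sha := by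
  haveI : Fact (Nat.Prime 2) := ⟨Nat.prime_two⟩
  obtain ⟨hHSY, hBF, hmod, -, -, -, -, hGZK, -, -, -⟩ := hF
  obtain ⟨hpr, h9, h3⟩ := hsy
  obtain ⟨hr, hfin, -⟩ :=
    Summit.BirchSwinnertonDyer.Rank1Residual.X12.CubeSumFamilies.bsdp_three_of_thm14' hHSY hBF hmod hpr h9 h3 W hW
  haveI := hfin
  have hq' : shaAn W = (q : ℂ) := hq W hW
  obtain ⟨⟨x, y, hx, hy, hx0, hy0, hxy⟩, hdiv⟩ := hS W hW
  have h16 : 2 ^ 4 ∣ Nat.card W.sha := by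
    simpa using sixteen_dvd_card_of_kleinFour_of_twoDivisible hx hy hx0 hy0 hxy hdiv
  have hcard : Nat.card W.sha ≠ 0 := (Nat.card_pos (α := W.sha)).ne'
  have hrank : W.mordellWeilRank = W.analyticRank := (hGZK W (by rw [hr])).1
  have hprim : padicValNat 2 (Nat.card (AddCommGroup.primaryComponent W.sha 2)) =
      padicValNat 2 (Nat.card W.sha) := padicValNat_card_addPrimaryComponent 2
  have h4 : 4 ≤ padicValNat 2 (Nat.card W.sha) := (padicValNat_dvd_iff_le hcard).mp h16
  constructor
  · rintro ⟨-, -, q', hqq, hvq⟩ h32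
    have hqq' : q' = q := by exact_mod_cast hqq.symm.trans hq'
    rw [hqq', hv, hprim] at hvq
    have h5 : 5 ≤ padicValNat 2 (Nat.card W.sha) :=
      (padicValNat_dvd_iff_le hcard).mp (by simpa using h32)
    omega
  · intro h32
    have hlt : padicValNat 2 (Nat.card W.sha) < 5 := by
      by_contra hge
      exact h32 (by simpa using (padicValNat_dvd_iff_le hcard).mpr (not_lt.mp hge))
    refine ⟨hrank, Finite.of_injective _ Subtype.val_injective, q, hq', ?_⟩
    rw [hv, hprim]
    have : padicValNat 2 (Nat.card W.sha) = 4 := by omega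
    exact_mod_cast this.symm

end Consumers

/-! ## §2 The member rows `2·10⁴ < p < 4·10⁴` (certified data: kit j252028; 2-descent census j250796);
the rows `4·10⁴ < p ≤ 10⁵` are in the sibling file `SylvesterTwoHeegnerIndexLowerHalfFourTorsionMembersB` -/

/-! ### `E_{30109} : x³ + y³ = 30109` (`p ≡ 4 (mod 9)`; conductor `27·30109²`; `#Ш_an = 16`) -/

/-- `30109` is an 𝒞_HSY parameter: prime, `30109 ≡ 4 (mod 9)`, and `3` is not a cube mod `30109`
(Euler: `3^((30109−1)/3) = 3^10036 ≢ 1 (mod 30109)`). [cite: HuShuYin2019, Thm. 1.4 (p. 3)] -/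
theorem hsy_30109 :
    Nat.Prime 30109 ∧ (30109 % 9 = 4 ∨ 30109 % 9 = 7) ∧ ¬ ∃ x : ZMod 30109, x ^ 3 = 3 :=
  hsy_of_pow_mod_ne_one (by norm_num) (Or.inl rfl) (by decide +kernel)

/-- **The LOWER crux `HeegnerIndexLowerAtTwoHSY` at `p = 30109`** (body verbatim, `p := 30109`), from
`PublishedFactsTwo` + two DISPLAYED certificates NOT proved in the kernel (kit j252028; reading key in the file header):
`hq : #Ш_an(E_{30109}) = 16` — `S ∈ [15.99877, 16.00025]` ∋ unique lattice point `4^2·1`; generator `(30109, 5208857)`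
(`ellrank`, `ĥ = 3.474859`, index bound `2`, witnesses `{2: [5, 6]}`); smallest cubic solution `(178)³ + (-169)³ = 30109·3³`; `#Ш(E_{3·30109²}) = 16`, `m(30109) = 4`,
`Cl(ℚ(∛(4·30109))) ≅ [30, 2]` (`bnfcertify` = 1), `k′ = 1` — and `hS : Ш(E_{30109})[2] ≅ (ℤ/2)² ⊆ 2·Ш(E_{30109})`
(`ellrank = [1, 3, 0]` at efforts `0–3`). Hence `ord₂ 𝔮 = 4 ≤ ord₂ #Ш(W)` in every frame. CONDITIONAL; EVIDENCE
consumer; says nothing about other `p`. [cite: HuShuYin2019, Thm. 1.3 and Thm. 1.4 (p. 3)]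
[cite: BurungaleFlach2024, Thm. 1.1 and Cor. 2] [cite: Miller2011LMS, §1 and Def. 1.1] [cite: Cremona1997, §3.6] -/
theorem sylvesterTwoHeegnerIndex_heegnerIndexLowerAtTwoHSY_30109 (hF : PublishedFactsTwo)
    (hq : ∀ (W : WeierstrassCurve ℚ) [W.IsElliptic] [W.IsGloballyMinimal],
      (∃ C : VariableChange ℚ, C • W = cubeSumCurve ((30109 : ℕ) : ℚ)) → shaAn W = ((16 : ℚ) : ℂ))
    (hS : ∀ (W : WeierstrassCurve ℚ) [W.IsElliptic] [W.IsGloballyMinimal],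
      (∃ C : VariableChange ℚ, C • W = cubeSumCurve ((30109 : ℕ) : ℚ)) →
        (∃ x y : W.sha, (2 : ℤ) • x = 0 ∧ (2 : ℤ) • y = 0 ∧ x ≠ 0 ∧ y ≠ 0 ∧ x ≠ y) ∧
        (∀ z : W.sha, (2 : ℤ) • z = 0 → ∃ w : W.sha, (2 : ℤ) • w = z)) :
    ∀ (W : WeierstrassCurve ℚ) [W.IsElliptic] [W.IsGloballyMinimal],
      (∃ C : VariableChange ℚ, C • W = cubeSumCurve ((30109 : ℕ) : ℚ)) →
      ∀ (N : ℕ) [NeZero N] (K : Type) [Field K] [NumberField K]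
        (Dt : ModularParametrizationData W N) (H : HeegnerDatum N (NumberField.discr K)) (ι : K →+* ℂ)
        (P : (W.baseChange K).toAffine.Point) (Wd : WeierstrassCurve ℚ) [Wd.IsElliptic]
        [Wd.IsGloballyMinimal] (Cd : VariableChange ℚ) (k : ℕ),
        W.HasCM → W.analyticRank = 1 → IsImaginaryQuadratic K → SatisfiesHeegnerHypothesis N K →
        WeierstrassCurve.Affine.Point.map ι.toRatAlgHom P = heegnerPointComplex Dt H →
        (W.quadraticTwist (NumberField.discr K : ℚ)).entireLFunction 1 ≠ 0 →
        Cd • W.quadraticTwist (NumberField.discr K : ℚ) = Wd → (k = 1 ∨ k = 2) →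
        (k = 2 ↔ ∀ y : W.toAffine.Point, ∃ Q : (W.baseChange K).toAffine.Point,
          QuadraticDescent.incl K W y - (2 : ℤ) • Q ∈ AddCommGroup.torsion (W.baseChange K).toAffine.Point) →
        padicValRat 2 (cmHeegnerIndexQuotient W K P Dt.c k Wd Cd.u) ≤
          padicValNat 2 (Nat.card W.sha) :=
  lower_member_of_cert hsy_30109 hF (q := 16) padicValRat_two_16.le hq hS

/-! ### `E_{31849} : x³ + y³ = 31849` (`p ≡ 7 (mod 9)`; conductor `9·31849²`; `#Ш_an = 16`) -/

/-- `31849` is an 𝒞_HSY parameter: prime, `31849 ≡ 7 (mod 9)`, and `3` is not a cube mod `31849`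
(Euler: `3^((31849−1)/3) = 3^10616 ≢ 1 (mod 31849)`). [cite: HuShuYin2019, Thm. 1.4 (p. 3)] -/
theorem hsy_31849 :
    Nat.Prime 31849 ∧ (31849 % 9 = 4 ∨ 31849 % 9 = 7) ∧ ¬ ∃ x : ZMod 31849, x ^ 3 = 3 :=
  hsy_of_pow_mod_ne_one (by norm_num) (Or.inr rfl) (by decide +kernel)

/-- **The LOWER crux `HeegnerIndexLowerAtTwoHSY` at `p = 31849`** (body verbatim, `p := 31849`), from
`PublishedFactsTwo` + two DISPLAYED certificates NOT proved in the kernel (kit j252028; reading key in the file header):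
`hq : #Ш_an(E_{31849}) = 16` — `S ∈ [15.99875, 16.00026]` ∋ unique lattice point `4^2·1`; generator `(95547/49, 2707165/343)`
(`ellrank`, `ĥ = 3.444107`, index bound `2`, witnesses `{2: [23, 24]}`); smallest cubic solution `(200)³ + (143)³ = 31849·7³`; `#Ш(E_{3·31849²}) = 16`, `m(31849) = 5`,
`Cl(ℚ(∛(4·31849))) ≅ [24]` (`bnfcertify` = 1), `k′ = 1` — and `hS : Ш(E_{31849})[2] ≅ (ℤ/2)² ⊆ 2·Ш(E_{31849})`
(`ellrank = [1, 3, 0]` at efforts `0–3`). Hence `ord₂ 𝔮 = 4 ≤ ord₂ #Ш(W)` in every frame. CONDITIONAL; EVIDENCE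
consumer; says nothing about other `p`. [cite: HuShuYin2019, Thm. 1.3 and Thm. 1.4 (p. 3)]
[cite: BurungaleFlach2024, Thm. 1.1 and Cor. 2] [cite: Miller2011LMS, §1 and Def. 1.1] [cite: Cremona1997, §3.6] -/
theorem sylvesterTwoHeegnerIndex_heegnerIndexLowerAtTwoHSY_31849 (hF : PublishedFactsTwo)
    (hq : ∀ (W : WeierstrassCurve ℚ) [W.IsElliptic] [W.IsGloballyMinimal],
      (∃ C : VariableChange ℚ, C • W = cubeSumCurve ((31849 : ℕ) : ℚ)) → shaAn W = ((16 : ℚ) : ℂ))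
    (hS : ∀ (W : WeierstrassCurve ℚ) [W.IsElliptic] [W.IsGloballyMinimal],
      (∃ C : VariableChange ℚ, C • W = cubeSumCurve ((31849 : ℕ) : ℚ)) →
        (∃ x y : W.sha, (2 : ℤ) • x = 0 ∧ (2 : ℤ) • y = 0 ∧ x ≠ 0 ∧ y ≠ 0 ∧ x ≠ y) ∧
        (∀ z : W.sha, (2 : ℤ) • z = 0 → ∃ w : W.sha, (2 : ℤ) • w = z)) :
    ∀ (W : WeierstrassCurve ℚ) [W.IsElliptic] [W.IsGloballyMinimal],
      (∃ C : VariableChange ℚ, C • W = cubeSumCurve ((31849 : ℕ) : ℚ)) →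
      ∀ (N : ℕ) [NeZero N] (K : Type) [Field K] [NumberField K]
        (Dt : ModularParametrizationData W N) (H : HeegnerDatum N (NumberField.discr K)) (ι : K →+* ℂ)
        (P : (W.baseChange K).toAffine.Point) (Wd : WeierstrassCurve ℚ) [Wd.IsElliptic]
        [Wd.IsGloballyMinimal] (Cd : VariableChange ℚ) (k : ℕ),
        W.HasCM → W.analyticRank = 1 → IsImaginaryQuadratic K → SatisfiesHeegnerHypothesis N K →
        WeierstrassCurve.Affine.Point.map ι.toRatAlgHom P = heegnerPointComplex Dt H →
        (W.quadraticTwist (NumberField.discr K : ℚ)).entireLFunction 1 ≠ 0 →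
        Cd • W.quadraticTwist (NumberField.discr K : ℚ) = Wd → (k = 1 ∨ k = 2) →
        (k = 2 ↔ ∀ y : W.toAffine.Point, ∃ Q : (W.baseChange K).toAffine.Point,
          QuadraticDescent.incl K W y - (2 : ℤ) • Q ∈ AddCommGroup.torsion (W.baseChange K).toAffine.Point) →
        padicValRat 2 (cmHeegnerIndexQuotient W K P Dt.c k Wd Cd.u) ≤
          padicValNat 2 (Nat.card W.sha) :=
  lower_member_of_cert hsy_31849 hF (q := 16) padicValRat_two_16.le hq hS

/-! ### `E_{31873} : x³ + y³ = 31873` (`p ≡ 4 (mod 9)`; conductor `27·31873²`; `#Ш_an = 16`) -/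

/-- `31873` is an 𝒞_HSY parameter: prime, `31873 ≡ 4 (mod 9)`, and `3` is not a cube mod `31873`
(Euler: `3^((31873−1)/3) = 3^10624 ≢ 1 (mod 31873)`). [cite: HuShuYin2019, Thm. 1.4 (p. 3)] -/
theorem hsy_31873 :
    Nat.Prime 31873 ∧ (31873 % 9 = 4 ∨ 31873 % 9 = 7) ∧ ¬ ∃ x : ZMod 31873, x ^ 3 = 3 :=
  hsy_of_pow_mod_ne_one (by norm_num) (Or.inl rfl) (by decide +kernel)

/-- **The LOWER crux `HeegnerIndexLowerAtTwoHSY` at `p = 31873`** (body verbatim, `p := 31873`), from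
`PublishedFactsTwo` + two DISPLAYED certificates NOT proved in the kernel (kit j252028; reading key in the file header):
`hq : #Ш_an(E_{31873}) = 16` — `S ∈ [15.99894, 16.00024]` ∋ unique lattice point `4^2·1`; generator `(31873/16, 1051809/64)`
(`ellrank`, `ĥ = 3.984253`, index bound `2`, witnesses `{2: [5, 6]}`); smallest cubic solution `(353)³ + (223)³ = 31873·12³`; `#Ш(E_{3·31873²}) = 529`, `m(31873) = 2`,
`Cl(ℚ(∛(4·31873))) ≅ [6, 6]` (`bnfcertify` = 1), `k′ = 0` — and `hS : Ш(E_{31873})[2] ≅ (ℤ/2)² ⊆ 2·Ш(E_{31873})`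
(`ellrank = [1, 3, 0]` at efforts `0–3`). Hence `ord₂ 𝔮 = 4 ≤ ord₂ #Ш(W)` in every frame. CONDITIONAL; EVIDENCE
consumer; says nothing about other `p`. [cite: HuShuYin2019, Thm. 1.3 and Thm. 1.4 (p. 3)]
[cite: BurungaleFlach2024, Thm. 1.1 and Cor. 2] [cite: Miller2011LMS, §1 and Def. 1.1] [cite: Cremona1997, §3.6] -/
theorem sylvesterTwoHeegnerIndex_heegnerIndexLowerAtTwoHSY_31873 (hF : PublishedFactsTwo)
    (hq : ∀ (W : WeierstrassCurve ℚ) [W.IsElliptic] [W.IsGloballyMinimal],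
      (∃ C : VariableChange ℚ, C • W = cubeSumCurve ((31873 : ℕ) : ℚ)) → shaAn W = ((16 : ℚ) : ℂ))
    (hS : ∀ (W : WeierstrassCurve ℚ) [W.IsElliptic] [W.IsGloballyMinimal],
      (∃ C : VariableChange ℚ, C • W = cubeSumCurve ((31873 : ℕ) : ℚ)) →
        (∃ x y : W.sha, (2 : ℤ) • x = 0 ∧ (2 : ℤ) • y = 0 ∧ x ≠ 0 ∧ y ≠ 0 ∧ x ≠ y) ∧
        (∀ z : W.sha, (2 : ℤ) • z = 0 → ∃ w : W.sha, (2 : ℤ) • w = z)) :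
    ∀ (W : WeierstrassCurve ℚ) [W.IsElliptic] [W.IsGloballyMinimal],
      (∃ C : VariableChange ℚ, C • W = cubeSumCurve ((31873 : ℕ) : ℚ)) →
      ∀ (N : ℕ) [NeZero N] (K : Type) [Field K] [NumberField K]
        (Dt : ModularParametrizationData W N) (H : HeegnerDatum N (NumberField.discr K)) (ι : K →+* ℂ)
        (P : (W.baseChange K).toAffine.Point) (Wd : WeierstrassCurve ℚ) [Wd.IsElliptic]
        [Wd.IsGloballyMinimal] (Cd : VariableChange ℚ) (k : ℕ),
        W.HasCM → W.analyticRank = 1 → IsImaginaryQuadratic K → SatisfiesHeegnerHypothesis N K →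
        WeierstrassCurve.Affine.Point.map ι.toRatAlgHom P = heegnerPointComplex Dt H →
        (W.quadraticTwist (NumberField.discr K : ℚ)).entireLFunction 1 ≠ 0 →
        Cd • W.quadraticTwist (NumberField.discr K : ℚ) = Wd → (k = 1 ∨ k = 2) →
        (k = 2 ↔ ∀ y : W.toAffine.Point, ∃ Q : (W.baseChange K).toAffine.Point,
          QuadraticDescent.incl K W y - (2 : ℤ) • Q ∈ AddCommGroup.torsion (W.baseChange K).toAffine.Point) →
        padicValRat 2 (cmHeegnerIndexQuotient W K P Dt.c k Wd Cd.u) ≤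
          padicValNat 2 (Nat.card W.sha) :=
  lower_member_of_cert hsy_31873 hF (q := 16) padicValRat_two_16.le hq hS

/-! ### `E_{34159} : x³ + y³ = 34159` (`p ≡ 4 (mod 9)`; conductor `27·34159²`; `#Ш_an = 16`) -/

/-- `34159` is an 𝒞_HSY parameter: prime, `34159 ≡ 4 (mod 9)`, and `3` is not a cube mod `34159`
(Euler: `3^((34159−1)/3) = 3^11386 ≢ 1 (mod 34159)`). [cite: HuShuYin2019, Thm. 1.4 (p. 3)] -/
theorem hsy_34159 :
    Nat.Prime 34159 ∧ (34159 % 9 = 4 ∨ 34159 % 9 = 7) ∧ ¬ ∃ x : ZMod 34159, x ^ 3 = 3 :=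
  hsy_of_pow_mod_ne_one (by norm_num) (Or.inl rfl) (by decide +kernel)

/-- **The LOWER crux `HeegnerIndexLowerAtTwoHSY` at `p = 34159`** (body verbatim, `p := 34159`), from
`PublishedFactsTwo` + two DISPLAYED certificates NOT proved in the kernel (kit j252028; reading key in the file header):
`hq : #Ш_an(E_{34159}) = 16` — `S ∈ [15.99947, 16.00011]` ∋ unique lattice point `4^2·1`; generator `(2288653/961, 1726737450/29791)`
(`ellrank`, `ĥ = 8.155250`, index bound `4`, witnesses `{2: [11, 12], 3: [5, 6]}`); smallest cubic solution `(199505)³ + (68614)³ = 34159·6231³`; `#Ш(E_{3·34159²}) = 4`, `m(34159) = 3`,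
`Cl(ℚ(∛(4·34159))) ≅ [6, 2]` (`bnfcertify` = 1), `k′ = 1` — and `hS : Ш(E_{34159})[2] ≅ (ℤ/2)² ⊆ 2·Ш(E_{34159})`
(`ellrank = [1, 3, 0]` at efforts `0–3`). Hence `ord₂ 𝔮 = 4 ≤ ord₂ #Ш(W)` in every frame. CONDITIONAL; EVIDENCE
consumer; says nothing about other `p`. [cite: HuShuYin2019, Thm. 1.3 and Thm. 1.4 (p. 3)]
[cite: BurungaleFlach2024, Thm. 1.1 and Cor. 2] [cite: Miller2011LMS, §1 and Def. 1.1] [cite: Cremona1997, §3.6] -/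
theorem sylvesterTwoHeegnerIndex_heegnerIndexLowerAtTwoHSY_34159 (hF : PublishedFactsTwo)
    (hq : ∀ (W : WeierstrassCurve ℚ) [W.IsElliptic] [W.IsGloballyMinimal],
      (∃ C : VariableChange ℚ, C • W = cubeSumCurve ((34159 : ℕ) : ℚ)) → shaAn W = ((16 : ℚ) : ℂ))
    (hS : ∀ (W : WeierstrassCurve ℚ) [W.IsElliptic] [W.IsGloballyMinimal],
      (∃ C : VariableChange ℚ, C • W = cubeSumCurve ((34159 : ℕ) : ℚ)) →
        (∃ x y : W.sha, (2 : ℤ) • x = 0 ∧ (2 : ℤ) • y = 0 ∧ x ≠ 0 ∧ y ≠ 0 ∧ x ≠ y) ∧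
        (∀ z : W.sha, (2 : ℤ) • z = 0 → ∃ w : W.sha, (2 : ℤ) • w = z)) :
    ∀ (W : WeierstrassCurve ℚ) [W.IsElliptic] [W.IsGloballyMinimal],
      (∃ C : VariableChange ℚ, C • W = cubeSumCurve ((34159 : ℕ) : ℚ)) →
      ∀ (N : ℕ) [NeZero N] (K : Type) [Field K] [NumberField K]
        (Dt : ModularParametrizationData W N) (H : HeegnerDatum N (NumberField.discr K)) (ι : K →+* ℂ)
        (P : (W.baseChange K).toAffine.Point) (Wd : WeierstrassCurve ℚ) [Wd.IsElliptic]
        [Wd.IsGloballyMinimal] (Cd : VariableChange ℚ) (k : ℕ),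
        W.HasCM → W.analyticRank = 1 → IsImaginaryQuadratic K → SatisfiesHeegnerHypothesis N K →
        WeierstrassCurve.Affine.Point.map ι.toRatAlgHom P = heegnerPointComplex Dt H →
        (W.quadraticTwist (NumberField.discr K : ℚ)).entireLFunction 1 ≠ 0 →
        Cd • W.quadraticTwist (NumberField.discr K : ℚ) = Wd → (k = 1 ∨ k = 2) →
        (k = 2 ↔ ∀ y : W.toAffine.Point, ∃ Q : (W.baseChange K).toAffine.Point,
          QuadraticDescent.incl K W y - (2 : ℤ) • Q ∈ AddCommGroup.torsion (W.baseChange K).toAffine.Point) →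
        padicValRat 2 (cmHeegnerIndexQuotient W K P Dt.c k Wd Cd.u) ≤
          padicValNat 2 (Nat.card W.sha) :=
  lower_member_of_cert hsy_34159 hF (q := 16) padicValRat_two_16.le hq hS


end SylvesterTwoLowerCert

end Summit.BirchSwinnertonDyer.BirchSwinnertonDyer.Theorems

end
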